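import Summits.QuantumFields.YangMills.Theorems.ContractibleFibreFibreToTorusConvexCountableNondiff
import Mathlib.Analysis.Convex.Deriv
import HarnessLib

/-!
# At a kink of a convex function the chord slopes on the two sides are strictly separated

Helper (pure real analysis, sub-goal G4 of the converse kink programme) for line `Sketch` of crux
`FibreToTorus` (stmt-QuantumFields-16244): if `f : ℝ → ℝ` is convex and NOT differentiable at
`x`, then with `s₁ := ∂⁻f(x) = derivWithin f (Iio x) x` and `s₂ := ∂⁺f(x) = derivWithin f (Ioi x) x`
one has `s₁ < s₂`, every chord from the left has slope `≤ s₁` and every chord to the right has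
slope `≥ s₂`.  Applied to the (convex) lattice pressure this separates the energies of Gibbs states
at couplings just below / just above a kink.

Proof: `s₁ ≤ s₂` always (`ConvexOn.leftDeriv_le_rightDeriv_of_mem_interior`); if `s₁ = s₂` the
two one-sided `HasDerivWithinAt` glue on `Iio x ∪ Ioi x = {x}ᶜ` to a `HasDerivAt`, contradicting
non-differentiability.  The chord bounds are `ConvexOn.slope_le_leftDeriv_of_mem_interior` and
`ConvexOn.rightDeriv_le_slope_of_mem_interior`, with `slope f a b = (f b - f a) / (b - a)` cleared
of its (positive) denominator.
-/

open Set Filter Topology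

namespace Summit.QuantumFields.YangMills.Theorems.FibreToTorus

/-- **Separated one-sided slopes at a kink of a convex function** (registered helper sub-goal
`kink_convex_separated_slopes`, G4): if `f : ℝ → ℝ` is convex on `ℝ` and not differentiable at
`x`, there are `s₁ < s₂` (namely the left and right derivatives of `f` at `x`) with
`f x - f y ≤ s₁ (x - y)` for all `y < x` and `s₂ (y - x) ≤ f y - f x` for all `y > x`.
[folklore] -/
theorem kink_convex_separated_slopes : ∀ (f : ℝ → ℝ) (x : ℝ), ConvexOn ℝ Set.univ f → ¬ DifferentiableAt ℝ f x → ∃ s₁ s₂ : ℝ, s₁ < s₂ ∧ (∀ y : ℝ, y < x → f x - f y ≤ s₁ * (x - y)) ∧ (∀ y : ℝ, x < y → s₂ * (y - x) ≤ f y - f x) := by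
  intro f x hfc hnd
  have hint : ∀ y : ℝ, y ∈ interior (univ : Set ℝ) := fun y ↦ by simp
  have hL : HasDerivWithinAt f (derivWithin f (Iio x) x) (Iio x) x :=
    hfc.hasDerivWithinAt_leftDeriv_of_mem_interior (hint x)
  have hR : HasDerivWithinAt f (derivWithin f (Ioi x) x) (Ioi x) x :=
    hfc.hasDerivWithinAt_rightDeriv_of_mem_interior (hint x)
  have h1 : derivWithin f (Iio x) x ≤ derivWithin f (Ioi x) x :=
    hfc.leftDeriv_le_rightDeriv_of_mem_interior (hint x)
  have hne : derivWithin f (Iio x) x ≠ derivWithin f (Ioi x) x := by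
    intro heq
    apply hnd
    rw [heq] at hL
    have hu : HasDerivWithinAt f (derivWithin f (Ioi x) x) (Iio x ∪ Ioi x) x := hL.union hR
    rw [Iio_union_Ioi, compl_eq_univ_sdiff, hasDerivWithinAt_sdiff_singleton,
      hasDerivWithinAt_univ] at hu
    exact hu.differentiableAt
  refine ⟨derivWithin f (Iio x) x, derivWithin f (Ioi x) x, lt_of_le_of_ne h1 hne, ?_, ?_⟩
  · intro y hy
    have hxy : 0 < x - y := sub_pos.mpr hy
    have hs : slope f y x ≤ derivWithin f (Iio x) x :=
      hfc.slope_le_leftDeriv_of_mem_interior (mem_univ y) (hint x) hy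
    rw [slope_def_field, div_le_iff₀ hxy] at hs
    exact hs
  · intro y hy
    have hxy : 0 < y - x := sub_pos.mpr hy
    have hs : derivWithin f (Ioi x) x ≤ slope f x y :=
      hfc.rightDeriv_le_slope_of_mem_interior (hint x) (mem_univ y) hy
    rw [slope_def_field, le_div_iff₀ hxy] at hs
    exact hs

end Summit.QuantumFields.YangMills.Theorems.FibreToTorus
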